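import Summits.BirchSwinnertonDyer.BirchSwinnertonDyer.Theorems.ClassRecordThreeEulerHalvesAtThreeEichlerShimuraTorsionCountD
import HarnessLib

/-!
# The torsion-refined Shapiro count over a field `K`, part E: trace counts and the exact codimension in CHARACTERISTIC ZERO

Helper file (route `ClassRecordThree`, crux `EulerHalvesAtThree`, print residue (SIGᶜ-lift)(ii); seat bsd-idea-10 g24, `--supports
stmt-BirchSwinnertonDyer-19109 --as helper`). Towards the EXACT count `6 dim_K H¹_{par,tors}(Γ, K) + 3ν₂ + 4ν₃ + 6ε_∞ = 12 + μ` over a field of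
characteristic `0` (part G; for `K = ℚ` it feeds the integral rank input (F3-rank) of the lifting recipe of `…EichlerShimuraModLift`), this file ports
the `ℝ`-arguments of `…EichlerShimuraLevelCountA` (§ trace counts) and `…LevelCountE` (§ total sum, exact codimension, dimension of the solution space)
to an arbitrary field `K` with `CharZero K`:
* `trace_eq_mul_finrank_range` (`A² = kA`, `k ≠ 0` ⇒ `tr A = k · rk A`), `relS_comp_relS`, `relST_comp_relST`, `trace_coperm`,
  `two_mul_finrank_range_relS` (`2 rk(1 + S^*) = μ + ν₂`), `three_mul_finrank_range_relST` (`3 rk(1 + U + U²) = μ + 2ν₃`);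
* `total`, `ker_relS_le_ker_total`, `ker_relST_le_ker_total`, `ker_cuspSum_le_ker_total`, `finrank_ker_total_add_one`,
  `ker_sup_ker_eq_ker_total` (`ker(1 + U + U²) + ker(cusp sums) = ker(total)`, from part A's refined codimension lemma);
* the UNREFINED solution space `solSpace₀ = {(a, b) : (1 + S^*)a = 0, (1 + U + U²)(T^*a + b) = 0, cusp sums of b = 0} ⊇ solSpace` and
  `finrank_solSpace₀_eq : dim W₀ = dim ker(1 + S^*) + dim(ker(1 + U + U²) ∩ ker(cusp sums))`.
No named facts; nothing specific to BSD; no summit statement is proved.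

## References
* G. Shimura, *Introduction to the arithmetic theory of automorphic functions* (1971), §8.1–8.2 [ShimuraIATAF1971].
-/

noncomputable section

open scoped MatrixGroups ModularForm

open CongruenceSubgroup Matrix.SpecialLinearGroup ModularGroup

set_option linter.dupNamespace false

namespace Summit.BirchSwinnertonDyer.BirchSwinnertonDyer.Theorems.EichlerShimuraLevelK

open _root_.Module _root_.LinearMap
open Literature.NumberTheory.EllipticCurves.ModularForms
open scoped Classical

variable {K : Type*} [Field K] {Γ : Subgroup SL(2, ℤ)}

/-! ### Projections up to a scalar: `tr A = k · rk A` -/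

/-- If `A² = k A` with `k ≠ 0` then `A/k` is the projection onto `range A`, so `trace A = k · dim range A` (any field). [folklore] -/
theorem trace_eq_mul_finrank_range {V : Type*} [AddCommGroup V] [Module K V] [FiniteDimensional K V]
    (A : V →ₗ[K] V) {k : K} (hk : k ≠ 0) (hA : A ∘ₗ A = k • A) :
    LinearMap.trace K V A = k * finrank K (range A) := by
  set P : V →ₗ[K] V := k⁻¹ • A with hP
  have hPidem : IsIdempotentElem P := by
    change P * P = P
    rw [hP, smul_mul_smul_comm, Module.End.mul_eq_comp, hA, smul_smul, mul_assoc, inv_mul_cancel₀ hk, mul_one]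
  have hrange : range P = range A := LinearMap.range_smul A k⁻¹ (inv_ne_zero hk)
  have htr := (LinearMap.IsIdempotentElem.isProj_range P hPidem).trace
  have hAP : LinearMap.trace K V A = k * LinearMap.trace K V P := by
    rw [hP, _root_.map_smul, smul_eq_mul, ← mul_assoc, mul_inv_cancel₀ hk, one_mul]
  rw [hAP, htr, hrange]

/-- `(1 + S^*)² = 2(1 + S^*)`. [folklore] -/
theorem relS_comp_relS [Fact ((-1 : SL(2, ℤ)) ∈ Γ)] : relS K Γ ∘ₗ relS K Γ = (2 : K) • relS K Γ := by
  rw [show (2 : K) = ((2 : ℕ) : K) by norm_num, Nat.cast_smul_eq_nsmul]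
  simp only [relS, LinearMap.add_comp, LinearMap.comp_add, LinearMap.id_comp, LinearMap.comp_id, coperm_S_comp_S]
  abel

/-- `(1 + U + U²)² = 3(1 + U + U²)` (`U = (ST)^*`, `U³ = 1`). [folklore] -/
theorem relST_comp_relST [Fact ((-1 : SL(2, ℤ)) ∈ Γ)] : relST K Γ ∘ₗ relST K Γ = (3 : K) • relST K Γ := by
  rw [show (3 : K) = ((3 : ℕ) : K) by norm_num, Nat.cast_smul_eq_nsmul]
  have h3 := coperm_ST_comp_ST_comp_ST (K := K) (Γ := Γ)
  simp only [relST, LinearMap.add_comp, LinearMap.comp_add, LinearMap.id_comp, LinearMap.comp_id, LinearMap.comp_assoc, h3]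
  abel

section Fin

variable [Fintype (SL(2, ℤ) ⧸ Γ)]

/-- **The trace of a permutation matrix is its number of fixed points.** [folklore] -/
theorem trace_coperm (g : SL(2, ℤ)) :
    LinearMap.trace K _ (coperm K Γ g) = ((Finset.univ.filter fun x : (SL(2, ℤ) ⧸ Γ) ↦ g • x = x).card : K) := by
  rw [LinearMap.trace_eq_matrix_trace K (Pi.basisFun K (SL(2, ℤ) ⧸ Γ)), Matrix.trace]
  simp only [Matrix.diag, LinearMap.toMatrix_apply, Pi.basisFun_repr, coperm_apply, Pi.basisFun_apply, Pi.single_apply]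
  rw [Finset.card_filter]
  push_cast
  rfl

/-- `2 dim range(1 + S^*) = μ + ν₂` with `ν₂ = #{x : Sx = x}` (characteristic `0`). [folklore] -/
theorem two_mul_finrank_range_relS [CharZero K] [Fact ((-1 : SL(2, ℤ)) ∈ Γ)] :
    2 * finrank K (range (relS K Γ)) =
      Fintype.card (SL(2, ℤ) ⧸ Γ) + (Finset.univ.filter fun q : (SL(2, ℤ) ⧸ Γ) ↦ S • q = q).card := by
  have h := trace_eq_mul_finrank_range (relS K Γ) two_ne_zero relS_comp_relS
  have htr : LinearMap.trace K _ (relS K Γ) =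
      (Fintype.card (SL(2, ℤ) ⧸ Γ) : K) + (Finset.univ.filter fun q : (SL(2, ℤ) ⧸ Γ) ↦ S • q = q).card := by
    rw [relS, map_add, LinearMap.trace_id, finrank_fintype_fun_eq_card, trace_coperm]
  rw [htr] at h
  exact_mod_cast h.symm

/-- `3 dim range(1 + U + U²) = μ + 2ν₃` with `ν₃ = #{x : STx = x}` (characteristic `0`). [folklore] -/
theorem three_mul_finrank_range_relST [CharZero K] [Fact ((-1 : SL(2, ℤ)) ∈ Γ)] :
    3 * finrank K (range (relST K Γ)) =
      Fintype.card (SL(2, ℤ) ⧸ Γ) + 2 * (Finset.univ.filter fun q : (SL(2, ℤ) ⧸ Γ) ↦ (S * T) • q = q).card := by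
  have h := trace_eq_mul_finrank_range (relST K Γ) three_ne_zero relST_comp_relST
  have h2 : coperm K Γ (S * T) ∘ₗ coperm K Γ (S * T) = coperm K Γ ((S * T) * (S * T)) := (coperm_mul _ _).symm
  have hfix : (Finset.univ.filter fun q : (SL(2, ℤ) ⧸ Γ) ↦ ((S * T) * (S * T)) • q = q) =
      Finset.univ.filter fun q : (SL(2, ℤ) ⧸ Γ) ↦ (S * T) • q = q :=
    Finset.filter_congr fun q _ ↦ by rw [mul_smul]; exact EichlerShimuraLevel.ST_smul_iff q
  have htr : LinearMap.trace K _ (relST K Γ) = (Fintype.card (SL(2, ℤ) ⧸ Γ) : K) +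
      2 * (Finset.univ.filter fun q : (SL(2, ℤ) ⧸ Γ) ↦ (S * T) • q = q).card := by
    rw [relST, map_add, map_add, LinearMap.trace_id, finrank_fintype_fun_eq_card, h2, trace_coperm, trace_coperm, hfix]
    ring
  rw [htr] at h
  exact_mod_cast h.symm

/-! ### The total-sum functional -/

variable (K Γ) in
/-- The total sum `f ↦ ∑_x f(x)` on `K^X`. [folklore] -/
def total : ((SL(2, ℤ) ⧸ Γ) → K) →ₗ[K] K where
  toFun f := ∑ x, f x
  map_add' f g := by simp [Finset.sum_add_distrib]
  map_smul' r f := by simp [Finset.mul_sum]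

/-- Unfolding `total`. [folklore] -/
@[simp] theorem total_apply (f : (SL(2, ℤ) ⧸ Γ) → K) : total K Γ f = ∑ x, f x := rfl

/-- The total sum is `g^*`-invariant. [folklore] -/
theorem total_coperm (g : SL(2, ℤ)) (f : (SL(2, ℤ) ⧸ Γ) → K) : total K Γ (coperm K Γ g f) = total K Γ f := by
  simp only [total_apply, coperm_apply]
  exact Fintype.sum_equiv (MulAction.toPerm g) (fun x ↦ f (g • x)) f fun _ ↦ rfl

/-- `ker(1 + U + U²) ≤ ker(total)` (`total ∘ (1 + U + U²) = 3 · total`; characteristic `≠ 3`). [folklore] -/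
theorem ker_relST_le_ker_total [CharZero K] : LinearMap.ker (relST K Γ) ≤ LinearMap.ker (total K Γ) := by
  intro c hc
  rw [LinearMap.mem_ker] at hc ⊢
  have h := congrArg (total K Γ) hc
  rw [map_zero] at h
  simp only [relST, LinearMap.add_apply, LinearMap.id_apply, LinearMap.comp_apply, map_add, total_coperm] at h
  have h3 : (3 : K) * total K Γ c = 0 := by linear_combination h
  simpa using h3

/-- `ker(1 + S^*) ≤ ker(total)` (`total ∘ (1 + S^*) = 2 · total`; characteristic `≠ 2`). [folklore] -/
theorem ker_relS_le_ker_total [CharZero K] : LinearMap.ker (relS K Γ) ≤ LinearMap.ker (total K Γ) := by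
  intro a ha
  rw [LinearMap.mem_ker] at ha ⊢
  have h := congrArg (total K Γ) ha
  rw [map_zero] at h
  simp only [relS, LinearMap.add_apply, LinearMap.id_apply, map_add, total_coperm] at h
  have h2 : (2 : K) * total K Γ a = 0 := by linear_combination h
  simpa using h2

/-- `dim ker(total) + 1 = #X`. [folklore] -/
theorem finrank_ker_total_add_one : finrank K (LinearMap.ker (total K Γ)) + 1 = Fintype.card (SL(2, ℤ) ⧸ Γ) := by
  have hsurj : Function.Surjective (total K Γ) := fun r ↦
    ⟨fun x ↦ if x = ((1 : SL(2, ℤ)) : (SL(2, ℤ) ⧸ Γ)) then r else 0, by simp⟩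
  have h := LinearMap.finrank_range_add_finrank_ker (total K Γ)
  rw [LinearMap.range_eq_top.mpr hsurj, finrank_top, Module.finrank_self, finrank_fintype_fun_eq_card] at h
  omega

variable [Γ.FiniteIndex]

/-- `ker(cusp sums) ≤ ker(total)` (the total is the sum of the cusp sums). [folklore] -/
theorem ker_cuspSum_le_ker_total : LinearMap.ker (cuspSum K Γ) ≤ LinearMap.ker (total K Γ) := by
  intro f hf
  rw [LinearMap.mem_ker] at hf ⊢
  rw [total_apply, ← Finset.sum_fiberwise_of_maps_to (s := Finset.univ) (t := Level.basePoints Γ)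
    (g := Level.base Γ) (fun x _ ↦ Level.base_mem_basePoints x) f]
  refine Finset.sum_eq_zero fun p hp ↦ ?_
  have h := congrFun hf ⟨p, hp⟩
  rw [cuspSum_apply, ← Level.filter_base_eq p (Finset.mem_filter.mp hp).2, Pi.zero_apply] at h
  convert h using 3
  exact Finset.ext fun x ↦ by simp

/-- **`ker(1 + U + U²) + ker(cusp sums) = ker(total)`** in characteristic `0` (exact codimension one; the dimension bound is part A's
`card_le_finrank_kerST_sup_add_one`, as `kerST ≤ ker(1 + U + U²)`). [folklore] -/
theorem ker_sup_ker_eq_ker_total [CharZero K] [Fact ((-1 : SL(2, ℤ)) ∈ Γ)] :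
    LinearMap.ker (relST K Γ) ⊔ LinearMap.ker (cuspSum K Γ) = LinearMap.ker (total K Γ) := by
  apply Submodule.eq_of_le_of_finrank_le (sup_le ker_relST_le_ker_total ker_cuspSum_le_ker_total)
  have h1 := card_le_finrank_kerST_sup_add_one (K := K) (Γ := Γ)
  have h2 := finrank_ker_total_add_one (K := K) (Γ := Γ)
  have hle : kerST K Γ ⊔ LinearMap.ker (cuspSum K Γ) ≤ LinearMap.ker (relST K Γ) ⊔ LinearMap.ker (cuspSum K Γ) :=
    sup_le_sup_right (fun b hb ↦ LinearMap.mem_ker.mpr hb.1) _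
  have h3 := Submodule.finrank_mono hle
  omega

end Fin

/-! ### The unrefined solution space and its dimension -/

section Sol

variable [Γ.FiniteIndex]

variable (K Γ) in
/-- The **unrefined solution space** `W₀ ⊆ K^X × K^X`: pairs `(a, b)` with `(1 + S^*)a = 0`, `(1 + U + U²)(T^*a + b) = 0` and
`cusp sums of b = 0` (the `K`-version of `EichlerShimuraLevel.solSpace`; it contains the refined `solSpace K Γ` of part D). [folklore] -/
def solSpace₀ : Submodule K (((SL(2, ℤ) ⧸ Γ) → K) × ((SL(2, ℤ) ⧸ Γ) → K)) :=
  (LinearMap.ker (relS K Γ)).comap (LinearMap.fst K _ _) ⊓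
    ((LinearMap.ker (relST K Γ)).comap (coperm K Γ T ∘ₗ LinearMap.fst K _ _ + LinearMap.snd K _ _) ⊓
      LinearMap.ker (cuspSum K Γ ∘ₗ LinearMap.snd K _ _))

/-- Membership in `solSpace₀`. [folklore] -/
theorem mem_solSpace₀_iff (p : ((SL(2, ℤ) ⧸ Γ) → K) × ((SL(2, ℤ) ⧸ Γ) → K)) :
    p ∈ solSpace₀ K Γ ↔ relS K Γ p.1 = 0 ∧ relST K Γ (coperm K Γ T p.1 + p.2) = 0 ∧ cuspSum K Γ p.2 = 0 := by
  simp [solSpace₀]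

/-- The refined solution space is contained in the unrefined one. [folklore] -/
theorem solSpace_le_solSpace₀ : solSpace K Γ ≤ solSpace₀ K Γ := fun p hp ↦ by
  obtain ⟨h1, h2, h3⟩ := (mem_solSpace_iff K Γ p).mp hp
  exact (mem_solSpace₀_iff p).mpr ⟨h1.1, h2.1, h3⟩

variable [Fintype (SL(2, ℤ) ⧸ Γ)]

/-- **`dim W₀ = dim ker(1 + S^*) + dim(ker(1 + U + U²) ∩ ker(cusp sums))`** (characteristic `0`): the projection of `W₀` to the first factor is
onto `ker(1 + S^*)` (by `ker_sup_ker_eq_ker_total`, every `a ∈ ker(1 + S^*)` is `c + d` with `(1 + U + U²)c = 0` and `d` of cusp sums zero; then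
`(a, c - T^*a) ∈ W₀`), with fibre `ker(1 + U + U²) ∩ ker(cusp sums)`. [folklore] -/
theorem finrank_solSpace₀_eq [CharZero K] [Fact ((-1 : SL(2, ℤ)) ∈ Γ)] :
    finrank K (solSpace₀ K Γ) = finrank K (LinearMap.ker (relS K Γ)) +
      finrank K ↥(LinearMap.ker (relST K Γ) ⊓ LinearMap.ker (cuspSum K Γ)) := by
  let π : solSpace₀ K Γ →ₗ[K] ((SL(2, ℤ) ⧸ Γ) → K) := LinearMap.fst K _ _ ∘ₗ (solSpace₀ K Γ).subtype
  have hπ := LinearMap.finrank_range_add_finrank_ker π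
  have hrange : LinearMap.range π = LinearMap.ker (relS K Γ) := by
    apply le_antisymm
    · rintro _ ⟨p, rfl⟩
      exact LinearMap.mem_ker.mpr ((mem_solSpace₀_iff p.1).mp p.2).1
    · intro a ha
      have ha' : a ∈ LinearMap.ker (relST K Γ) ⊔ LinearMap.ker (cuspSum K Γ) := by
        rw [ker_sup_ker_eq_ker_total]
        exact ker_relS_le_ker_total ha
      obtain ⟨c, hc, d, hd, hcd⟩ := Submodule.mem_sup.mp ha'
      rw [LinearMap.mem_ker] at ha hc hd
      have hmem : (a, c - coperm K Γ T a) ∈ solSpace₀ K Γ := by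
        rw [mem_solSpace₀_iff]
        refine ⟨ha, by rwa [add_sub_cancel], ?_⟩
        rw [map_sub, cuspSum_coperm_T, ← hcd, map_add, hd, add_zero, sub_self]
      exact ⟨⟨_, hmem⟩, rfl⟩
  rw [hrange] at hπ
  let ψ : LinearMap.ker π →ₗ[K] ((SL(2, ℤ) ⧸ Γ) → K) :=
    LinearMap.snd K _ _ ∘ₗ (solSpace₀ K Γ).subtype ∘ₗ (LinearMap.ker π).subtype
  have hker : ∀ p : LinearMap.ker π, ((p : solSpace₀ K Γ) : ((SL(2, ℤ) ⧸ Γ) → K) × ((SL(2, ℤ) ⧸ Γ) → K)).1 = 0 :=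
    fun p ↦ LinearMap.mem_ker.mp p.2
  have hψinj : Function.Injective ψ := by
    intro p q hpq
    apply Subtype.ext
    apply Subtype.ext
    exact Prod.ext (by rw [hker p, hker q]) hpq
  have hψrange : LinearMap.range ψ = LinearMap.ker (relST K Γ) ⊓ LinearMap.ker (cuspSum K Γ) := by
    apply le_antisymm
    · rintro _ ⟨p, rfl⟩
      obtain ⟨-, h2, h3⟩ := (mem_solSpace₀_iff _).mp (p : solSpace₀ K Γ).2
      rw [hker p, map_zero, zero_add] at h2
      exact ⟨LinearMap.mem_ker.mpr h2, LinearMap.mem_ker.mpr h3⟩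
    · rintro c ⟨hc, hc'⟩
      rw [SetLike.mem_coe, LinearMap.mem_ker] at hc hc'
      have hmem : ((0 : (SL(2, ℤ) ⧸ Γ) → K), c) ∈ solSpace₀ K Γ := by
        rw [mem_solSpace₀_iff]
        exact ⟨map_zero _, by rwa [map_zero, zero_add], hc'⟩
      have hmem' : (⟨_, hmem⟩ : solSpace₀ K Γ) ∈ LinearMap.ker π := by
        rw [LinearMap.mem_ker]
        rfl
      exact ⟨⟨_, hmem'⟩, rfl⟩
  have h2 := LinearMap.finrank_range_of_inj hψinj
  rw [hψrange] at h2
  omega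

end Sol

end Summit.BirchSwinnertonDyer.BirchSwinnertonDyer.Theorems.EichlerShimuraLevelK

end
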